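import Summits.CriticalPhenomena.PercolationContinuityZ3.Theorems.PercNearOneGluingNoHeavyPcintChordMemZ5B10Defs
import HarnessLib

/-!
# PCINT lane, kernel reduced-state B3r certificate `Z5B10` (bond, d = 5, memory τ = 10, 6192 state classes): row checks 9 (rows [5600, 6192))

Cell `prim-pcint`, seat `prim-pcint-2` (gen 4); memo `run/shared/lean/prim/pcint/REDUCTIONS.md` §B3r and HANDOFF ("B3r on reduced states").
Does NOT build on p205010.  Data for `BondK.le_criticalProb_of_checkRowsB` (`…PcintChordMemKernelCert`): `p = 11480/100000`,
`s̄ = 99339/100000` (`s̄²+p² ≥ 1`), refund `r = 100666/100000` (`s̄·r ≥ 1`, `(1-p)·r ≤ 1`), `κ̄ = (100000+99339)/(2·100000)`, `λ = 99999/100000`;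
Collatz–Wielandt weights (scale 10⁹) from a power iteration (ρ ≈ 0.9993014), exact off-line max row ratio 0.9993014437 < λ.
Generated by work/gen/gen_b3r_kernel.py (prim-pcint-2 gen 4 folder; copy in run/shared/lean/prim/pcint/prim-pcint-2/kernel/); the kernel re-checks every row.
-/

namespace Summit.CriticalPhenomena.PercolationContinuityZ3.Theorems.Pcint.ChordMemZ5B10

set_option maxHeartbeats 0 in
/-- Rows `[5600, 5700)` pass the check. [folklore] -/
theorem chk_5600 : WinK.allRange (BondK.checkRowB 10 5 6192 11480 100666 99339 100000 99999 100000 ChordMemZ5B10.syms ChordMemZ5B10.tree) 5600 5700 = true :=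
  WinK.allRange_of_allRangeB (fuel := 8) (lo := 5600) (len := 100) (by decide +kernel)

set_option maxHeartbeats 0 in
/-- Rows `[5700, 5800)` pass the check. [folklore] -/
theorem chk_5700 : WinK.allRange (BondK.checkRowB 10 5 6192 11480 100666 99339 100000 99999 100000 ChordMemZ5B10.syms ChordMemZ5B10.tree) 5700 5800 = true :=
  WinK.allRange_of_allRangeB (fuel := 8) (lo := 5700) (len := 100) (by decide +kernel)

set_option maxHeartbeats 0 in
/-- Rows `[5800, 5900)` pass the check. [folklore] -/
theorem chk_5800 : WinK.allRange (BondK.checkRowB 10 5 6192 11480 100666 99339 100000 99999 100000 ChordMemZ5B10.syms ChordMemZ5B10.tree) 5800 5900 = true :=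
  WinK.allRange_of_allRangeB (fuel := 8) (lo := 5800) (len := 100) (by decide +kernel)

set_option maxHeartbeats 0 in
/-- Rows `[5900, 6000)` pass the check. [folklore] -/
theorem chk_5900 : WinK.allRange (BondK.checkRowB 10 5 6192 11480 100666 99339 100000 99999 100000 ChordMemZ5B10.syms ChordMemZ5B10.tree) 5900 6000 = true :=
  WinK.allRange_of_allRangeB (fuel := 8) (lo := 5900) (len := 100) (by decide +kernel)

set_option maxHeartbeats 0 in
/-- Rows `[6000, 6100)` pass the check. [folklore] -/
theorem chk_6000 : WinK.allRange (BondK.checkRowB 10 5 6192 11480 100666 99339 100000 99999 100000 ChordMemZ5B10.syms ChordMemZ5B10.tree) 6000 6100 = true :=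
  WinK.allRange_of_allRangeB (fuel := 8) (lo := 6000) (len := 100) (by decide +kernel)

set_option maxHeartbeats 0 in
/-- Rows `[6100, 6192)` pass the check. [folklore] -/
theorem chk_6100 : WinK.allRange (BondK.checkRowB 10 5 6192 11480 100666 99339 100000 99999 100000 ChordMemZ5B10.syms ChordMemZ5B10.tree) 6100 6192 = true :=
  WinK.allRange_of_allRangeB (fuel := 8) (lo := 6100) (len := 92) (by decide +kernel)

/-- Rows `[5600, 6192)` pass the check. [folklore] -/
theorem file_9 : WinK.allRange (BondK.checkRowB 10 5 6192 11480 100666 99339 100000 99999 100000 ChordMemZ5B10.syms ChordMemZ5B10.tree) 5600 6192 = true := (WinK.allRange_split (WinK.allRange_split (WinK.allRange_split (WinK.allRange_split (WinK.allRange_split chk_5600 chk_5700) chk_5800) chk_5900) chk_6000) chk_6100)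

end Summit.CriticalPhenomena.PercolationContinuityZ3.Theorems.Pcint.ChordMemZ5B10
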